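import Mathlib
import Summits.Ventures.PercRepro2.Defs
import Summits.Ventures.PercRepro2.Graph
import Summits.Ventures.PercRepro2.HullDefs
import Summits.Ventures.PercRepro2.LocRows
import Summits.Ventures.PercRepro2.SwRow
import Summits.Ventures.PercRepro2.SwAllRow

/-!
# Row (PA-l), part 1: the hull datum of `l`, the blue-favourable order and the coupling (blind cell PercRepro2, night-4 g8,
2026-08-25; proofs/NIGHT4-G8.md §1–§2)

Free fibre (uniform 2-colouring, blue = `Hull.blue ζ`), marks `l, h, o`; `A = C_R(l)`, `B = C_B(l)`,
`U = A ∪ B` the hull of `l`.  The HULL DATUM of `ζ` is its colouring on the edges touching `U`; its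
class `hullClass` is a cylinder (domain Markov), on which the outside is free.  The only hull
edges the blue cluster of `h ∉ U` can use are the BLUE edges touching `R_side(l)` (`gadB`), the only
ones its red cluster can use are the RED edges touching `B_side(l)` (`gadR`); `freeE` is the outside.

* `HullLe ζ ζ'` — the blue-favourable order: `gadB ζ ⊆ gadB ζ'`, `freeE ζ ∪ gadB ζ ⊆ freeE ζ' ∪ gadB ζ'`,
  `gadR ζ' ⊆ gadR ζ`, `freeE ζ' ∪ gadR ζ' ⊆ freeE ζ ∪ gadR ζ`;
* **`HullOrdDom`** (row (PA-l)): an injection of `{h ∉ H_l, o ∈ B_side}` into `{h ∉ H_l, o ∈ R_side}`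
  with `HullLe x (f x)` — the law of the hull datum of `l` on `{h ∉ H_l, o ∈ R_side}` dominates its
  law on `{h ∉ H_l, o ∈ B_side}` in the blue-favourable order (census 0 failures n ≤ 6);
* `cluster_blue_subset_mix` / `card_mul_le_of_hullLe`: the monotone coupling — an involution of
  `class × class'` swapping the colours on the common free edges; every blue edge inside `C_B(h)`
  is a gadget edge or a free blue edge and never touches `B`, so `C_B(h)` only grows:
  `#(class ζ ∩ {C_B(h) ∈ 𝓥}) · #class ζ' ≤ #(class ζ' ∩ {C_B(h) ∈ 𝓥}) · #class ζ` for `HullLe ζ ζ'`.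

Part 2 (`HullOrd.lean`): the class proportion and **`sw_of_hullOrdDom : HullOrdDom → Sw`**.
-/

namespace Summit.Ventures.PercRepro2

namespace LocRows

open Hull

variable {V : Type*} {E : Type*} [Fintype E] [DecidableEq E]

open scoped Classical

variable (ends : E → Sym2 V)

/-! ## The hull datum, its class and the gadgets -/

/-- The class of the hull datum of `ζ`: the configurations agreeing with `ζ` on every edge touching
the hull of `l`. -/
noncomputable def hullClass (l : V) (ζ : Config E) : Finset (Config E) :=
  Finset.univ.filter fun ζ' => ∀ e ∈ touches ends (hull ends ζ l), ζ' e = ζ e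

/-- The blue gadget: the blue edges touching the red side of `l`. -/
def gadB (l : V) (ζ : Config E) : Set E :=
  {e | e ∈ touches ends (rside ends ζ l) ∧ ζ e = false}

/-- The red gadget: the red edges touching the blue side of `l`. -/
def gadR (l : V) (ζ : Config E) : Set E :=
  {e | e ∈ touches ends (bside ends ζ l) ∧ ζ e = true}

/-- The outside: the edges not touching the hull of `l`. -/
def freeE (l : V) (ζ : Config E) : Set E := (touches ends (hull ends ζ l))ᶜ

/-- **The blue-favourable order on hull data**: the blue gadget and the blue-available set grow, the
red gadget and the red-available set shrink. -/
def HullLe (l : V) (ζ ζ' : Config E) : Prop :=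
  gadB ends l ζ ⊆ gadB ends l ζ' ∧ freeE ends l ζ ∪ gadB ends l ζ ⊆ freeE ends l ζ' ∪ gadB ends l ζ' ∧
    gadR ends l ζ' ⊆ gadR ends l ζ ∧ freeE ends l ζ' ∪ gadR ends l ζ' ⊆ freeE ends l ζ ∪ gadR ends l ζ

/-- **Row (PA-l)**: an injection of `{h ∉ H_l, o ∈ B_side}` into `{h ∉ H_l, o ∈ R_side}` along which
the hull datum of `l` grows in the blue-favourable order. -/
def HullOrdDom (l h o : V) : Prop :=
  ∃ f : {ζ // ζ ∈ srcU ends l h {S : Set V | o ∈ S}} → Config E, Function.Injective f ∧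
    ∀ x, f x ∈ tgtU ends l h {S : Set V | o ∈ S} ∧ HullLe ends l x.1 (f x)

variable {ends}

omit [Fintype E] [DecidableEq E] in
/-- `touches` is monotone. -/
lemma touches_mono {S T : Set V} (h : S ⊆ T) : touches ends S ⊆ touches ends T :=
  fun _ ⟨x, hx, y, hxy⟩ => ⟨x, h hx, y, hxy⟩

omit [Fintype E] [DecidableEq E] in
/-- Agreeing on the edges touching the hull of `l` fixes the red cluster of `l`. -/
lemma cluster_eq_of_hullAgree {l : V} {ζ ζ' : Config E}
    (hag : ∀ e ∈ touches ends (hull ends ζ l), ζ' e = ζ e) :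
    cluster ends ζ' l = cluster ends ζ l :=
  cluster_eq_of_eqOn_touches (ω := ζ) (ω' := ζ')
    (fun e he => (hag e (touches_mono Set.subset_union_left he)).symm) rfl

omit [Fintype E] [DecidableEq E] in
/-- Agreeing on the edges touching the hull of `l` fixes the blue cluster of `l`. -/
lemma cluster_blue_eq_of_hullAgree {l : V} {ζ ζ' : Config E}
    (hag : ∀ e ∈ touches ends (hull ends ζ l), ζ' e = ζ e) :
    cluster ends (blue ζ') l = cluster ends (blue ζ) l :=
  cluster_eq_of_eqOn_touches (ω := blue ζ) (ω' := blue ζ')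
    (fun e he => by
      simp only [blue_apply, hag e (touches_mono Set.subset_union_right he)]) rfl

omit [Fintype E] [DecidableEq E] in
/-- Agreeing on the edges touching the hull of `l` fixes the hull. -/
lemma hull_eq_of_hullAgree {l : V} {ζ ζ' : Config E}
    (hag : ∀ e ∈ touches ends (hull ends ζ l), ζ' e = ζ e) :
    hull ends ζ' l = hull ends ζ l := by
  simp only [hull, cluster_eq_of_hullAgree hag, cluster_blue_eq_of_hullAgree hag]

/-- Membership in the class. -/
lemma mem_hullClass {l : V} {ζ ζ' : Config E} :
    ζ' ∈ hullClass ends l ζ ↔ ∀ e ∈ touches ends (hull ends ζ l), ζ' e = ζ e := by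
  simp only [hullClass, Finset.mem_filter, Finset.mem_univ, true_and]

/-- The class is reflexive. -/
lemma self_mem_hullClass (l : V) (ζ : Config E) : ζ ∈ hullClass ends l ζ :=
  mem_hullClass.2 fun _ _ => rfl

/-- Members of a class have the same class. -/
lemma hullClass_eq_of_mem {l : V} {ζ ζ' : Config E} (h : ζ' ∈ hullClass ends l ζ) :
    hullClass ends l ζ' = hullClass ends l ζ := by
  rw [mem_hullClass] at h
  ext ζ''
  simp only [mem_hullClass, hull_eq_of_hullAgree h]
  constructor
  · intro h' e he; rw [h' e he, h e he]
  · intro h' e he; rw [h' e he, ← h e he]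

/-- The class relation is symmetric. -/
lemma mem_hullClass_symm {l : V} {ζ ζ' : Config E} (h : ζ' ∈ hullClass ends l ζ) :
    ζ ∈ hullClass ends l ζ' := by
  rw [hullClass_eq_of_mem h]; exact self_mem_hullClass l ζ

/-- The red side is constant on a class. -/
lemma rside_eq_of_mem {l : V} {ζ ζ' : Config E} (h : ζ' ∈ hullClass ends l ζ) :
    rside ends ζ' l = rside ends ζ l := by
  rw [mem_hullClass] at h
  simp only [rside, cluster_eq_of_hullAgree h, cluster_blue_eq_of_hullAgree h]

/-- The blue side is constant on a class. -/
lemma bside_eq_of_mem {l : V} {ζ ζ' : Config E} (h : ζ' ∈ hullClass ends l ζ) :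
    bside ends ζ' l = bside ends ζ l := by
  rw [mem_hullClass] at h
  simp only [bside, cluster_eq_of_hullAgree h, cluster_blue_eq_of_hullAgree h]

/-- The hull is constant on a class. -/
lemma hull_eq_of_mem {l : V} {ζ ζ' : Config E} (h : ζ' ∈ hullClass ends l ζ) :
    hull ends ζ' l = hull ends ζ l :=
  hull_eq_of_hullAgree (mem_hullClass.1 h)

/-- The outside is constant on a class. -/
lemma freeE_eq_of_mem {l : V} {ζ ζ' : Config E} (h : ζ' ∈ hullClass ends l ζ) :
    freeE ends l ζ' = freeE ends l ζ := by
  simp only [freeE, hull_eq_of_mem h]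

/-- The blue gadget is constant on a class. -/
lemma gadB_eq_of_mem {l : V} {ζ ζ' : Config E} (h : ζ' ∈ hullClass ends l ζ) :
    gadB ends l ζ' = gadB ends l ζ := by
  have hag := mem_hullClass.1 h
  ext e
  simp only [gadB, Set.mem_setOf_eq, rside_eq_of_mem h]
  constructor
  · rintro ⟨he, hc⟩
    refine ⟨he, ?_⟩
    rw [← hag e (touches_mono (rside_subset_hull_sdiff_core ζ l |>.trans
      Set.sdiff_subset) he)]
    exact hc
  · rintro ⟨he, hc⟩
    refine ⟨he, ?_⟩
    rw [hag e (touches_mono (rside_subset_hull_sdiff_core ζ l |>.trans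
      Set.sdiff_subset) he)]
    exact hc

/-- The red gadget is constant on a class. -/
lemma gadR_eq_of_mem {l : V} {ζ ζ' : Config E} (h : ζ' ∈ hullClass ends l ζ) :
    gadR ends l ζ' = gadR ends l ζ := by
  have hag := mem_hullClass.1 h
  ext e
  simp only [gadR, Set.mem_setOf_eq, bside_eq_of_mem h]
  constructor
  · rintro ⟨he, hc⟩
    refine ⟨he, ?_⟩
    rw [← hag e (touches_mono (bside_subset_hull_sdiff_core ζ l |>.trans
      Set.sdiff_subset) he)]
    exact hc
  · rintro ⟨he, hc⟩
    refine ⟨he, ?_⟩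
    rw [hag e (touches_mono (bside_subset_hull_sdiff_core ζ l |>.trans
      Set.sdiff_subset) he)]
    exact hc

/-- `HullLe` only depends on the classes. -/
lemma hullLe_of_mem {l : V} {ζ ζ' ζ₁ ζ₁' : Config E} (h₁ : ζ₁ ∈ hullClass ends l ζ)
    (h₁' : ζ₁' ∈ hullClass ends l ζ') (hle : HullLe ends l ζ ζ') : HullLe ends l ζ₁ ζ₁' := by
  simpa only [HullLe, gadB_eq_of_mem h₁, gadB_eq_of_mem h₁', gadR_eq_of_mem h₁, gadR_eq_of_mem h₁',
    freeE_eq_of_mem h₁, freeE_eq_of_mem h₁'] using hle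

/-- The source side of (PA-l) is a union of classes. -/
lemma mem_srcU_of_mem {l h o : V} {ζ ζ' : Config E} (h' : ζ' ∈ hullClass ends l ζ)
    (hζ : ζ ∈ srcU ends l h {S : Set V | o ∈ S}) : ζ' ∈ srcU ends l h {S : Set V | o ∈ S} := by
  have hag := mem_hullClass.1 h'
  simp only [srcU, Finset.mem_filter, Finset.mem_univ, true_and, Set.mem_setOf_eq] at hζ ⊢
  simpa only [hull_eq_of_hullAgree hag, cluster_eq_of_hullAgree hag,
    cluster_blue_eq_of_hullAgree hag] using hζ

/-- The target side of (PA-l) is a union of classes. -/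
lemma mem_tgtU_of_mem {l h o : V} {ζ ζ' : Config E} (h' : ζ' ∈ hullClass ends l ζ)
    (hζ : ζ ∈ tgtU ends l h {S : Set V | o ∈ S}) : ζ' ∈ tgtU ends l h {S : Set V | o ∈ S} := by
  have hag := mem_hullClass.1 h'
  simp only [tgtU, Finset.mem_filter, Finset.mem_univ, true_and, Set.mem_setOf_eq] at hζ ⊢
  simpa only [hull_eq_of_hullAgree hag, cluster_eq_of_hullAgree hag,
    cluster_blue_eq_of_hullAgree hag] using hζ

/-! ## The mixing involution and the monotone coupling -/

/-- Replace the colours of `a` on `C` by those of `b`. -/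
noncomputable def mix (C : Set E) (a b : Config E) : Config E := fun e => if e ∈ C then b e else a e

omit [Fintype E] [DecidableEq E] in
/-- `mix` on `C` and off `C`. -/
lemma mix_apply (C : Set E) (a b : Config E) (e : E) :
    mix C a b e = if e ∈ C then b e else a e := rfl

omit [Fintype E] [DecidableEq E] in
/-- Mixing twice gives back the first configuration. -/
lemma mix_mix (C : Set E) (a b : Config E) : mix C (mix C a b) (mix C b a) = a := by
  funext e; by_cases he : e ∈ C <;> simp [mix, he]

/-- Mixing on a set of free edges stays in the class. -/
lemma mix_mem_hullClass {l : V} {ζ : Config E} {C : Set E} (hC : C ⊆ freeE ends l ζ)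
    {a : Config E} (ha : a ∈ hullClass ends l ζ) (b : Config E) :
    mix C a b ∈ hullClass ends l ζ := by
  rw [mem_hullClass] at ha ⊢
  intro e he
  have : e ∉ C := fun hc => (hC hc) he
  simp only [mix, this, if_false]
  exact ha e he

omit [Fintype E] [DecidableEq E] in
/-- An edge inside the blue cluster of `h ∉ H_l` does not touch the blue cluster of `l`. -/
lemma not_touches_blue_of_within {l h : V} {a : Config E} (hh : h ∉ hull ends a l) {e : E}
    (he : e ∈ within ends (cluster ends (blue a) h)) :
    e ∉ touches ends (cluster ends (blue a) l) := by
  rintro ⟨x, hx, y, hxy⟩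
  obtain ⟨x', hx', y', hy', hxy'⟩ := he
  have hmem : x ∈ cluster ends (blue a) h := by
    rw [hxy] at hxy'
    rw [Sym2.eq_iff] at hxy'
    rcases hxy' with ⟨rfl, _⟩ | ⟨rfl, _⟩
    · exact hx'
    · exact hy'
  apply hh
  refine Or.inr ?_
  simp only [mem_cluster] at hx hmem ⊢
  exact conn_trans hx (conn_symm hmem)

omit [Fintype E] [DecidableEq E] in
/-- An edge touching the hull but not the blue cluster of `l` touches the red side. -/
lemma mem_touches_rside_of_not_blue {l : V} {a : Config E} {e : E}
    (he : e ∈ touches ends (hull ends a l)) (hb : e ∉ touches ends (cluster ends (blue a) l)) :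
    e ∈ touches ends (rside ends a l) := by
  obtain ⟨x, hx, y, hxy⟩ := he
  have hxB : x ∉ cluster ends (blue a) l := fun h => hb ⟨x, h, y, hxy⟩
  rcases hx with hxA | hxB'
  · exact ⟨x, ⟨hxA, hxB⟩, y, hxy⟩
  · exact absurd hxB' hxB

/-- **The monotone coupling**: if `HullLe ζ ζ'`, `h ∉ H_l(ζ)`, `a` is in the class of `ζ` and `b` in the
class of `ζ'`, then the blue cluster of `h` in `a` is contained in the blue cluster of `h` in the
configuration `b` mixed with `a` on the common free edges. -/
lemma cluster_blue_subset_mix {l h : V} {ζ ζ' : Config E} (hh : h ∉ hull ends ζ l)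
    (hle : HullLe ends l ζ ζ') {a b : Config E} (ha : a ∈ hullClass ends l ζ)
    (hb : b ∈ hullClass ends l ζ') :
    cluster ends (blue a) h ⊆
      cluster ends (blue (mix (freeE ends l ζ ∩ freeE ends l ζ') b a)) h := by
  obtain ⟨h1, h2, _, _⟩ := hle
  have hha : h ∉ hull ends a l := by rwa [hull_eq_of_mem ha]
  refine cluster_subset_of_red_flipped ends ?_
  intro e he hred
  rw [blue_apply, Bool.not_eq_true'] at hred
  have hnb := not_touches_blue_of_within hha he
  -- a gadget edge of `ζ'` is blue in `b`, hence in the mix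
  have key : e ∈ gadB ends l ζ' → mix (freeE ends l ζ ∩ freeE ends l ζ') b a e = false := by
    rintro ⟨het, hc⟩
    have hnf : e ∉ freeE ends l ζ' := fun hf =>
      hf (touches_mono (rside_subset_hull_sdiff_core ζ' l |>.trans Set.sdiff_subset) het)
    have hnC : e ∉ freeE ends l ζ ∩ freeE ends l ζ' := fun hC => hnf hC.2
    simp only [mix, hnC, if_false]
    rw [mem_hullClass] at hb
    rw [hb e (touches_mono (rside_subset_hull_sdiff_core ζ' l |>.trans Set.sdiff_subset) het)]
    exact hc
  by_cases hU : e ∈ touches ends (hull ends ζ l)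
  · -- a hull edge: it touches the red side and is blue, so it is a blue gadget edge of `ζ`
    have hU' : e ∈ touches ends (hull ends a l) := by rwa [hull_eq_of_mem ha]
    have hr : e ∈ touches ends (rside ends a l) := mem_touches_rside_of_not_blue hU' hnb
    have hg : e ∈ gadB ends l ζ := by
      rw [← gadB_eq_of_mem ha]; exact ⟨hr, hred⟩
    exact key (h1 hg)
  · -- a free edge of `ζ`: free in `ζ'` (then the mix copies `a`) or a blue gadget edge of `ζ'`
    have hf : e ∈ freeE ends l ζ := hU
    rcases h2 (Or.inl hf) with hf' | hg'
    · have hC : e ∈ freeE ends l ζ ∩ freeE ends l ζ' := ⟨hf, hf'⟩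
      simp only [mix, hC, if_true]
      exact hred
    · exact key hg'

/-! ## The coupling inequality -/

/-- **The coupling inequality**: `#(class ζ ∩ 𝓔) · #class ζ' ≤ #(class ζ' ∩ 𝓔) · #class ζ` for
`HullLe ζ ζ'`, `h ∉ H_l(ζ)` and an up-set `𝓥`. -/
lemma card_mul_le_of_hullLe {l h : V} {𝓥 : Set (Set V)} (h𝓥 : IsUpperSet 𝓥) {ζ ζ' : Config E}
    (hh : h ∉ hull ends ζ l) (hle : HullLe ends l ζ ζ') :
    ((hullClass ends l ζ).filter fun a => cluster ends (blue a) h ∈ 𝓥).card *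
        (hullClass ends l ζ').card ≤
      ((hullClass ends l ζ').filter fun b => cluster ends (blue b) h ∈ 𝓥).card *
        (hullClass ends l ζ).card := by
  set C := freeE ends l ζ ∩ freeE ends l ζ' with hCdef
  rw [← Finset.card_product, ← Finset.card_product]
  refine Finset.card_le_card_of_injOn (fun p => (mix C p.2 p.1, mix C p.1 p.2)) ?_ ?_
  · rintro ⟨a, b⟩ hab
    rw [Finset.mem_coe, Finset.mem_product, Finset.mem_filter] at hab
    obtain ⟨⟨ha, hV⟩, hb⟩ := hab
    rw [Finset.mem_coe, Finset.mem_product, Finset.mem_filter]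
    exact ⟨⟨mix_mem_hullClass (C := C) Set.inter_subset_right hb a,
      h𝓥 (cluster_blue_subset_mix hh hle ha hb) hV⟩,
      mix_mem_hullClass (C := C) Set.inter_subset_left ha b⟩
  · rintro ⟨a, b⟩ _ ⟨a', b'⟩ _ hEq
    simp only [Prod.mk.injEq] at hEq
    obtain ⟨h1, h2⟩ := hEq
    have ea : a = a' := by
      rw [← mix_mix C a b, h2, h1, mix_mix]
    have eb : b = b' := by
      rw [← mix_mix C b a, h1, h2, mix_mix]
    rw [ea, eb]

end LocRows

end Summit.Ventures.PercRepro2
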